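/-
Origin: expansion seat `planner-pub-hodgecm-mc-axioms-1-g14-0`, handover #W26 2026-08-20T15:53:55Z md5 714e876e9f3d (PKG 7e81093282f2 → 714e876e9f3d; 265 l.; MECHANICAL (iib-R) rewrite v3.1 of the PKG file as it stands (372 token edits; rules R1x1+RX[h₂]x371)) (`HOME/mc/pub-hodgecm-mc-axioms-1-g14/revendor/kit-r55/stage55/HodgeCM/Model/E2InstanceR9.lean`, md5 714e876e9f3d, 265 lines);
landed by the gen-22 packager (p-g22) in gate run 55 REPLACES the earlier landed copy of `HodgeCM/Model/E2InstanceR9.lean` (seat copy carried the packager Origin header of an earlier run (stripped)).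
-/
/-
Origin: CONSTRUCTION seat `planner-pub-hodgecm-mc-glue-1-g6-0` (unit pub-hodgecm-mc-glue-1-g6, gen 6 of mc-glue-1, node E ASSEMBLER), 2026-08-19T18:00Z — revision (§60) of `HodgeCM/Model/E2InstanceR9.lean` for RUN 37: the (Θ-sat-≤) ORDER CASCADE (BINDER-TRIAGE §60: theta saturation in the `K`-order `Γ' ≤ Γ :↔ Γ'.K ≤ Γ.K` of the (W1) `Level`-pair root, covers `cover Γ Γ' (Level.Γ_mono h)`), forced by the K-order `Model.thetaSatOf` (theta-3-g9 t37 #C2); kit `mc/pub-hodgecm-mc-glue-1-g6/t37c-mcglue1g6.txt`; base PKG (RUN-35 bytes, glue-1 lineage). REPLACE — binder `thetaSat` re-typed to the K-order at its 3 occurrences, as R6; from R10 on (`thetaSat := Model.thetaSatOf … hA hι`, theta-3 t37 #C2 778996c3b32b) the E text is unchanged and now elaborates. Kernel only: 0 `proof-hole`, 0 new declarations, cites nothing new; expected `#print axioms` unchanged (⊆ {propext, Classical.choice, Quot.sound}).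
-/
/-
Origin: expansion seat `planner-pub-hodgecm-mc-glue-1-g4-0`, handover #307 2026-08-19T01:13Z md5 3102bd1021a2a62cd1d40303f7f0ca38 (NEW additive leaf, 254 l.; node E revision 9 = revision 8 core with the theta-space binder `X` PINNED at `fun V c => Model.thetaSpaceInputOf hHD hI h₁ h₃ S V c` (mc-theta-3-g3 #6 `ThetaSpaceInputPin`, design (B)) and `A : SupplySituationAt` replaced by (`C : … → Model.ArchKTypeData (thetaSpaceInputIn … (S V c) hV) k N`, `hol`); decls  (`HOME/mc/pub-hodgecm-mc-glue-1-g4/lean/E2InstanceR9.lean`, md5 3102bd10, 254 lines);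
landed by the gen-9 packager (p-g9) in gate run 33 as `HodgeCM/Model/E2InstanceR9.lean` (verbatim).
-/
/-
Origin: CONSTRUCTION seat `planner-pub-hodgecm-mc-glue-1-g4-0` (unit pub-hodgecm-mc-glue-1-g4, gen 4 of mc-glue-1,
node E ASSEMBLER), 2026-08-19.  NEW additive leaf `HodgeCM/Model/E2InstanceR9.lean`.  Imports: `E2InstanceR8`
(revision 8 core `Model.perL_picardCM_r8core` and everything below it) and `ThetaSpaceInputPin` (mc-theta-3-g3,
design (B): `Model.thetaSpaceInputOf`, `Model.ThetaAdelicSide`, `Model.thetaSpaceInputIn`,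
`Model.isAnisotropic_of_goodCtx`, `Model.thetaSpaceInputOf_of_isAnisotropic`; it imports mc-autform-2-g4's
`ClassMapInstance` (node D1-aut (C2), `Model.classMapDatumOf`)).  The CORE theorem `Model.perL_picardCM_r9core`
(statement and proof) is mc-theta-3-g3's compiled offer `mc/pub-hodgecm-mc-theta-3-g3/lean/offer/HodgeCM/Model/
E2InstanceR9.lean` (md5 2c7d86572097) adopted verbatim under the one-writer rule for `E2Instance*`; the two
headlines are this seat's.  No proof holes; every undischarged input is an explicit binder.  Expected `#print axioms`:
{propext, Classical.choice, Quot.sound}.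
-/
import Summits.HodgeConjecture.HodgeCM.Model.E2InstanceR8
import Summits.HodgeConjecture.HodgeCM.Model.ThetaSpaceInputPin_2

/-!
# E2 instance, revision 9: the theta-space binder `X` PINNED at `Model.thetaSpaceInputOf … S`

Revision 8 (`Model/E2InstanceR8.lean`) still carried the free theta-space family
`X : ∀ V c, Model.ThetaSpaceInput (picardCMUniverse …) V c` and one opaque supply binder
`A : … → (X V c).SupplySituationAt k N`.  mc-theta-3-g3's `Model/ThetaSpaceInputPin.lean` constructs the theta-space
input: `Model.thetaSpaceInputOf hHD hI h₁ h₃ S V c` (a `dite` on `IsAnisotropic L V.Hm`, exactly like `Model.embOf`;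
regime branch `thetaSpaceInputIn … (S V c) hV` = group `U21`, `K₁ := stabilizer U21 x₀`, weight
`(BallForms.isPullbackCocycle_cotangentCocycle).weightOf x₀`, level images `(ballDatumOf … Γ h).ballImage (frameOf …)`,
class-map datum `Model.classMapDatumOf …` (mc-autform-2-g4, (C2)); off-regime branch with theta classes provably `{0}`)
from ONE named DATA binder

* `S : ∀ {L ι₁} (V : HermSpace3 L ι₁) (c : SeesawCtx L), Model.ThetaAdelicSide V c` — the four Weil pair
  representations `P k` over the MODEL's adelic unitary group `(V.latticeModel printFact_unitaryCompact_holds).G`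
  (Weil 1964), the rational-points equation `hΓU`, and the archimedean component `ιinf` per level ((F-frame)).

Revision 9 = revision 8's core with `X ↦ fun V c => Model.thetaSpaceInputOf hHD hI h₁ h₃ S V c` (kept
eta-expanded on purpose: mc-theta-3-g3's lemmas are stated over this literal form) and `A` replaced by the two
theta-side binders of `Model/ThetaSpaceInputPin.lean` § 5, verbatim:

* `C : ∀ {L ι₁} (V) (c) (hV : IsAnisotropic L V.Hm), T.GoodCtx ι₁ c → Module.finrank ℚ c.K = 6 → ∀ k : Fin 4,
  k = 0 ∨ k = 1 → ∀ N : ℕ, 0 < N → Model.ArchKTypeData (thetaSpaceInputIn hHD hI h₁ h₃ (S V c) hV) k N` —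
  level-`N` archimedean `K`-type DATA (mc-theta-3-g3 `Model/ArchKType.lean`: `Γ₀(N)`, `K₂ κ₂ K∞ Φarch ℓ₀` and the
  named Prop fields `fixN` (W-Kf′), `prodN` (W-⊗′), `harm` (W-K∞′), `arch₀`);
* `hol` — (W6b-hol): the restricted theta forms of `(C …).toProduct` are holomorphic, verbatim the `hol` argument of
  `Model.ProductKTypeData.toSupplySituationAt`.

The regime hypothesis `hV` the producers receive is derived in the proof from `hc` + `h6`
(`Model.isAnisotropic_of_goodCtx`), so E passes nothing extra.  Binder count: 17 (`hHR h hA W S μ hBetti h31|hR|hd ha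
hLiu thetaSat transl C hol gen12 real34 hyp12 hyp34`); net vs revision 8: −`X` (PINNED, a `def`), −`A`, +`S` (DATA),
+`C` (DATA with Prop fields), +`hol`.

* `Model.perL_picardCM_r9core` — `h31 : U.Fact_cmInflation` a parameter (mc-theta-3-g3's compiled offer, adopted);
* `Model.perL_picardCM_r9` — HEADLINE, the core at `h31 := Model.fact_cmInflation_riemann hHD hI h₃ h₁ hR`;
* `Model.perL_picardCM_r9s` — the core at `h31 := Model.fact_cmInflation_printed hHD hI h₃ h₁ hd ha`.

Bounce-isolated: nothing imports this file; if it (or `ThetaSpaceInputPin` / `ClassMapInstance` below it) is not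
installed, revision 8 (`Model/E2InstanceR8.lean`, `Model/E2InstanceR8A.lean`) stands unchanged.
-/

noncomputable section

open scoped TensorProduct InnerProductSpace Matrix

namespace HodgeCM

namespace Model

open HodgeCM.Universe (AdelicThetaCore AdelicThetaCore₀ SideData ThetaModel ModelAxiomsPerL)
open Literature.AlgebraicGeometry.HodgeTheory
open Literature.AlgebraicGeometry.ComplexMultiplication (Shimura1998_Thm3_isogenousPower Shimura1998_Thm2_Cor)
open Literature.NumberTheory.Automorphic.PicardCM
open Literature.NumberTheory.Transcendental (Arapura2012_Cor_15_4_6)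
open HodgeCM.CMTypeOps (inflate)
open HodgeCM.Model.SupplyResidual (ClassSupplyPackN)
open HodgeCM.Model.ThetaSpace

variable (hHD : exists_isReal_hodgeModel) (hI : hodgePQ_independent_of_hodgeModel)
  (h₁ : BallQuotientUniformised)  (h₃ : CMAbelianVarietyRealised)

/-- **E2 instance, revision 9 — CORE at the theta-space PIN** (see the module docstring); `h31 : U.Fact_cmInflation` is a
parameter.  Statement and proof: mc-theta-3-g3's compiled offer, adopted verbatim. -/
theorem perL_picardCM_r9core (hHR : BettiUniverse.HodgeRiemann20) (h : Bool)
    (hA : Arapura2012_Cor_15_4_6)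
    (W : ∀ {L : CMField} {ι₁ : L →+* ℂ} (V : HermSpace3 L ι₁) (c : SeesawCtx L), WmInput V c.D)
    (S : ∀ {L : CMField} {ι₁ : L →+* ℂ} (V : HermSpace3 L ι₁) (c : SeesawCtx L), ThetaAdelicSide V c)
    (μ : ∀ {L : CMField}, SeesawCtx L → Fin 4 → NumberField.InfinitePlace L → ℤ)
    (hBetti : ∀ {L : CMField} {ι₁ : L →+* ℂ} (V : HermSpace3 L ι₁), EmbBettiSide hHD hI h₁ h₃ V)
    (h31 : (picardCMUniverse hHD hI h₁ h₃).Fact_cmInflation)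
    (hLiu : ∀ {L : CMField} {ι₁ : L →+* ℂ} (V : HermSpace3 L ι₁) (c : SeesawCtx L),
      (thetaModelOf hHD hI h₁ h₃ h (embOf hHD hI h₁ h₃) (coverOf hHD hI h₁ h₃ hA) (wmOfInput W) (thetaOf _ (thetaClassInputOf _ (fun V c => thetaSpaceInputOf hHD hI h₁ h₃ S V c))) (d12Of μ) (d34Of μ)).GoodCtx ι₁ c → Module.finrank ℚ c.K = 6 →
      ∀ (i : Fin 4) (Γ : Level V), ∃ (M : CMField) (k : c.K →+* M) (σ' : M →+* ℂ), σ'.comp k = c.σ ∧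
        (thetaModelOf hHD hI h₁ h₃ h (embOf hHD hI h₁ h₃) (coverOf hHD hI h₁ h₃ hA) (wmOfInput W) (thetaOf _ (thetaClassInputOf _ (fun V c => thetaSpaceInputOf hHD hI h₁ h₃ S V c))) (d12Of μ) (d34Of μ)).Theta V c i Γ ⊆
          (picardCMUniverse hHD hI h₁ h₃).Uiso Γ M (inflate k (c.Ψ i)) σ')
    (thetaSat : ∀ {L : CMField} {ι₁ : L →+* ℂ} (V : HermSpace3 L ι₁) (c : SeesawCtx L)
      (i : Fin 4) (Γ Γ' : Level V) (hle : Γ' ≤ Γ) (ω : (picardCMUniverse hHD hI h₁ h₃).CohC ((picardCMUniverse hHD hI h₁ h₃).pms L ι₁ V Γ) 1),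
      ω ∈ (thetaModelOf hHD hI h₁ h₃ h (embOf hHD hI h₁ h₃) (coverOf hHD hI h₁ h₃ hA) (wmOfInput W) (thetaOf _ (thetaClassInputOf _ (fun V c => thetaSpaceInputOf hHD hI h₁ h₃ S V c))) (d12Of μ) (d34Of μ)).Theta V c i Γ →
        (picardCMUniverse hHD hI h₁ h₃).pullC (coverOf hHD hI h₁ h₃ hA Γ Γ' (Level.Γ_mono hle)) 1 ω ∈ (thetaModelOf hHD hI h₁ h₃ h (embOf hHD hI h₁ h₃) (coverOf hHD hI h₁ h₃ hA) (wmOfInput W) (thetaOf _ (thetaClassInputOf _ (fun V c => thetaSpaceInputOf hHD hI h₁ h₃ S V c))) (d12Of μ) (d34Of μ)).Theta V c i Γ')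
    (transl : ∀ {L : CMField} {ι₁ : L →+* ℂ} (V : HermSpace3 L ι₁) (c : SeesawCtx L)
      (hc : (thetaModelOf hHD hI h₁ h₃ h (embOf hHD hI h₁ h₃) (coverOf hHD hI h₁ h₃ hA) (wmOfInput W) (thetaOf _ (thetaClassInputOf _ (fun V c => thetaSpaceInputOf hHD hI h₁ h₃ S V c))) (d12Of μ) (d34Of μ)).GoodCtx ι₁ c) (hK : Module.finrank ℚ c.K = 6),
      ∀ γ ∈ (ballOf hHD hI h₁ h₃ V c (two_lt_finrank_of_goodCtx hHD hI h₁ h₃ hc hK)).Δ, ∀ (i : Fin 4) (Γ : Level V) (ω : (picardCMUniverse hHD hI h₁ h₃).CohC ((picardCMUniverse hHD hI h₁ h₃).pms L ι₁ V Γ) 1),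
      ω ∈ (thetaModelOf hHD hI h₁ h₃ h (embOf hHD hI h₁ h₃) (coverOf hHD hI h₁ h₃ hA) (wmOfInput W) (thetaOf _ (thetaClassInputOf _ (fun V c => thetaSpaceInputOf hHD hI h₁ h₃ S V c))) (d12Of μ) (d34Of μ)).Theta V c i Γ → ∃ (Γ' : Level V) (ω' : (picardCMUniverse hHD hI h₁ h₃).CohC ((picardCMUniverse hHD hI h₁ h₃).pms L ι₁ V Γ') 1),
        ω' ∈ (thetaModelOf hHD hI h₁ h₃ h (embOf hHD hI h₁ h₃) (coverOf hHD hI h₁ h₃ hA) (wmOfInput W) (thetaOf _ (thetaClassInputOf _ (fun V c => thetaSpaceInputOf hHD hI h₁ h₃ S V c))) (d12Of μ) (d34Of μ)).Theta V c i Γ' ∧ (ballOf hHD hI h₁ h₃ V c (two_lt_finrank_of_goodCtx hHD hI h₁ h₃ hc hK)).ev Γ' ω' =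
          fun x => (ballOf hHD hI h₁ h₃ V c (two_lt_finrank_of_goodCtx hHD hI h₁ h₃ hc hK)).J γ x *ᵥ (ballOf hHD hI h₁ h₃ V c (two_lt_finrank_of_goodCtx hHD hI h₁ h₃ hc hK)).ev Γ ω (γ • x))
    (C : ∀ {L : CMField} {ι₁ : L →+* ℂ} (V : HermSpace3 L ι₁) (c : SeesawCtx L) (hV : IsAnisotropic L V.Hm),
      (thetaModelOf hHD hI h₁ h₃ h (embOf hHD hI h₁ h₃) (coverOf hHD hI h₁ h₃ hA) (wmOfInput W) (thetaOf _ (thetaClassInputOf _ (fun V c => thetaSpaceInputOf hHD hI h₁ h₃ S V c))) (d12Of μ) (d34Of μ)).GoodCtx ι₁ c →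
      Module.finrank ℚ c.K = 6 → ∀ k : Fin 4, k = 0 ∨ k = 1 → ∀ N : ℕ, 0 < N →
        ArchKTypeData (thetaSpaceInputIn hHD hI h₁ h₃ (S V c) hV) k N)
    (hol : ∀ {L : CMField} {ι₁ : L →+* ℂ} (V : HermSpace3 L ι₁) (c : SeesawCtx L) (hV : IsAnisotropic L V.Hm)
      (hc : (thetaModelOf hHD hI h₁ h₃ h (embOf hHD hI h₁ h₃) (coverOf hHD hI h₁ h₃ hA) (wmOfInput W) (thetaOf _ (thetaClassInputOf _ (fun V c => thetaSpaceInputOf hHD hI h₁ h₃ S V c))) (d12Of μ) (d34Of μ)).GoodCtx ι₁ c)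
      (h6 : Module.finrank ℚ c.K = 6) (k : Fin 4) (hk : k = 0 ∨ k = 1) (N : ℕ) (hN : 0 < N),
      ∀ f ∈ ((thetaSpaceInputIn hHD hI h₁ h₃ (S V c) hV).P k).weightFunctions,
        (C V c hV hc h6 k hk N hN).toProduct.restrictedThetaForm f ∈
          ((thetaSpaceInputIn hHD hI h₁ h₃ (S V c) hV).D (C V c hV hc h6 k hk N hN).Γ₀).Hol)
    (gen12 : ∀ {L : CMField} {ι₁ : L →+* ℂ} (V : HermSpace3 L ι₁) (c : SeesawCtx L),
      (thetaModelOf hHD hI h₁ h₃ h (embOf hHD hI h₁ h₃) (coverOf hHD hI h₁ h₃ hA) (wmOfInput W) (thetaOf _ (thetaClassInputOf _ (fun V c => thetaSpaceInputOf hHD hI h₁ h₃ S V c))) (d12Of μ) (d34Of μ)).GoodCtx ι₁ c → Module.finrank ℚ c.K = 6 →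
      Nonempty ((thetaModelOf hHD hI h₁ h₃ h (embOf hHD hI h₁ h₃) (coverOf hHD hI h₁ h₃ hA) (wmOfInput W) (thetaOf _ (thetaClassInputOf _ (fun V c => thetaSpaceInputOf hHD hI h₁ h₃ S V c))) (d12Of μ) (d34Of μ)).Gen12FunBridge V c))
    (real34 : ∀ {L : CMField} {ι₁ : L →+* ℂ} (V : HermSpace3 L ι₁) (c : SeesawCtx L),
      (thetaModelOf hHD hI h₁ h₃ h (embOf hHD hI h₁ h₃) (coverOf hHD hI h₁ h₃ hA) (wmOfInput W) (thetaOf _ (thetaClassInputOf _ (fun V c => thetaSpaceInputOf hHD hI h₁ h₃ S V c))) (d12Of μ) (d34Of μ)).GoodCtx ι₁ c → Module.finrank ℚ c.K = 6 →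
      Nonempty ((thetaModelOf hHD hI h₁ h₃ h (embOf hHD hI h₁ h₃) (coverOf hHD hI h₁ h₃ hA) (wmOfInput W) (thetaOf _ (thetaClassInputOf _ (fun V c => thetaSpaceInputOf hHD hI h₁ h₃ S V c))) (d12Of μ) (d34Of μ)).Real34FunBridge V c))
    (hyp12 : ∀ {L : CMField} {ι₁ : L →+* ℂ} (V : HermSpace3 L ι₁) (c : SeesawCtx L),
      (thetaModelOf hHD hI h₁ h₃ h (embOf hHD hI h₁ h₃) (coverOf hHD hI h₁ h₃ hA) (wmOfInput W) (thetaOf _ (thetaClassInputOf _ (fun V c => thetaSpaceInputOf hHD hI h₁ h₃ S V c))) (d12Of μ) (d34Of μ)).GoodCtx ι₁ c → Module.finrank ℚ c.K = 6 →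
      Nonempty (((coreOf _ (embOf hHD hI h₁ h₃) (coverOf hHD hI h₁ h₃ hA) (wmOfInput W) (thetaOf _ (thetaClassInputOf _ (fun V c => thetaSpaceInputOf hHD hI h₁ h₃ S V c)))).toCore h).HypSmoothCore12
        (((coreOf _ (embOf hHD hI h₁ h₃) (coverOf hHD hI h₁ h₃ hA) (wmOfInput W) (thetaOf _ (thetaClassInputOf _ (fun V c => thetaSpaceInputOf hHD hI h₁ h₃ S V c)))).toCore h).side12 (d12Of μ)) (((coreOf _ (embOf hHD hI h₁ h₃) (coverOf hHD hI h₁ h₃ hA) (wmOfInput W) (thetaOf _ (thetaClassInputOf _ (fun V c => thetaSpaceInputOf hHD hI h₁ h₃ S V c)))).toCore h).side34 (d34Of μ))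
        ((((coreOf _ (embOf hHD hI h₁ h₃) (coverOf hHD hI h₁ h₃ hA) (wmOfInput W) (thetaOf _ (thetaClassInputOf _ (fun V c => thetaSpaceInputOf hHD hI h₁ h₃ S V c)))).toCore h).analyticKM (((coreOf _ (embOf hHD hI h₁ h₃) (coverOf hHD hI h₁ h₃ hA) (wmOfInput W) (thetaOf _ (thetaClassInputOf _ (fun V c => thetaSpaceInputOf hHD hI h₁ h₃ S V c)))).toCore h).side12 (d12Of μ))
          (((coreOf _ (embOf hHD hI h₁ h₃) (coverOf hHD hI h₁ h₃ hA) (wmOfInput W) (thetaOf _ (thetaClassInputOf _ (fun V c => thetaSpaceInputOf hHD hI h₁ h₃ S V c)))).toCore h).side34 (d34Of μ))).toAnalytic) V c (ℓ := linOfInput W V c)))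
    (hyp34 : ∀ {L : CMField} {ι₁ : L →+* ℂ} (V : HermSpace3 L ι₁) (c : SeesawCtx L),
      (thetaModelOf hHD hI h₁ h₃ h (embOf hHD hI h₁ h₃) (coverOf hHD hI h₁ h₃ hA) (wmOfInput W) (thetaOf _ (thetaClassInputOf _ (fun V c => thetaSpaceInputOf hHD hI h₁ h₃ S V c))) (d12Of μ) (d34Of μ)).GoodCtx ι₁ c → Module.finrank ℚ c.K = 6 →
      Nonempty (((coreOf _ (embOf hHD hI h₁ h₃) (coverOf hHD hI h₁ h₃ hA) (wmOfInput W) (thetaOf _ (thetaClassInputOf _ (fun V c => thetaSpaceInputOf hHD hI h₁ h₃ S V c)))).toCore h).HypSmoothCore34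
        (((coreOf _ (embOf hHD hI h₁ h₃) (coverOf hHD hI h₁ h₃ hA) (wmOfInput W) (thetaOf _ (thetaClassInputOf _ (fun V c => thetaSpaceInputOf hHD hI h₁ h₃ S V c)))).toCore h).side12 (d12Of μ)) (((coreOf _ (embOf hHD hI h₁ h₃) (coverOf hHD hI h₁ h₃ hA) (wmOfInput W) (thetaOf _ (thetaClassInputOf _ (fun V c => thetaSpaceInputOf hHD hI h₁ h₃ S V c)))).toCore h).side34 (d34Of μ))
        ((((coreOf _ (embOf hHD hI h₁ h₃) (coverOf hHD hI h₁ h₃ hA) (wmOfInput W) (thetaOf _ (thetaClassInputOf _ (fun V c => thetaSpaceInputOf hHD hI h₁ h₃ S V c)))).toCore h).analyticKM (((coreOf _ (embOf hHD hI h₁ h₃) (coverOf hHD hI h₁ h₃ hA) (wmOfInput W) (thetaOf _ (thetaClassInputOf _ (fun V c => thetaSpaceInputOf hHD hI h₁ h₃ S V c)))).toCore h).side12 (d12Of μ))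
          (((coreOf _ (embOf hHD hI h₁ h₃) (coverOf hHD hI h₁ h₃ hA) (wmOfInput W) (thetaOf _ (thetaClassInputOf _ (fun V c => thetaSpaceInputOf hHD hI h₁ h₃ S V c)))).toCore h).side34 (d34Of μ))).toAnalytic) V c (ℓ := linOfInput W V c))) :
     (picardCMUniverse hHD hI h₁ h₃).PerL :=
  perL_picardCM_r8core hHD hI h₁ h₃ hHR h hA W (fun V c => thetaSpaceInputOf hHD hI h₁ h₃ S V c) μ hBetti h31
    hLiu thetaSat transl
    (fun V c hc h6 k hk N hN => Classical.choice (by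
      have hV := isAnisotropic_of_goodCtx V hc h6
      show Nonempty (SupplySituationAt (thetaSpaceInputOf hHD hI h₁ h₃ S V c) k N)
      rw [thetaSpaceInputOf_of_isAnisotropic hHD hI h₁ h₃ S V c hV]
      exact ⟨(C V c hV hc h6 k hk N hN).toSupplySituationAt (hol V c hV hc h6 k hk N hN)⟩))
    gen12 real34 hyp12 hyp34

/-- **E2 instance, revision 9 — HEADLINE (Riemann route).** `Model.perL_picardCM_r9core` at
`h31 := Model.fact_cmInflation_riemann hHD hI h₃ h₁ hR` (mc-axioms-1-g4, node D3-geom (v5) rev 3); binder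
`hR : DeligneMilne1982_Thm_6_20_full` (Deligne–Milne 1982, Thm 6.20, p. 82) replaces `h31`; no `hd`/`ha`. -/
theorem perL_picardCM_r9 (hHR : BettiUniverse.HodgeRiemann20) (h : Bool)
    (hA : Arapura2012_Cor_15_4_6)
    (W : ∀ {L : CMField} {ι₁ : L →+* ℂ} (V : HermSpace3 L ι₁) (c : SeesawCtx L), WmInput V c.D)
    (S : ∀ {L : CMField} {ι₁ : L →+* ℂ} (V : HermSpace3 L ι₁) (c : SeesawCtx L), ThetaAdelicSide V c)
    (μ : ∀ {L : CMField}, SeesawCtx L → Fin 4 → NumberField.InfinitePlace L → ℤ)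
    (hBetti : ∀ {L : CMField} {ι₁ : L →+* ℂ} (V : HermSpace3 L ι₁), EmbBettiSide hHD hI h₁ h₃ V)
    (hR : DeligneMilne1982_Thm_6_20_full)
    (hLiu : ∀ {L : CMField} {ι₁ : L →+* ℂ} (V : HermSpace3 L ι₁) (c : SeesawCtx L),
      (thetaModelOf hHD hI h₁ h₃ h (embOf hHD hI h₁ h₃) (coverOf hHD hI h₁ h₃ hA) (wmOfInput W) (thetaOf _ (thetaClassInputOf _ (fun V c => thetaSpaceInputOf hHD hI h₁ h₃ S V c))) (d12Of μ) (d34Of μ)).GoodCtx ι₁ c → Module.finrank ℚ c.K = 6 →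
      ∀ (i : Fin 4) (Γ : Level V), ∃ (M : CMField) (k : c.K →+* M) (σ' : M →+* ℂ), σ'.comp k = c.σ ∧
        (thetaModelOf hHD hI h₁ h₃ h (embOf hHD hI h₁ h₃) (coverOf hHD hI h₁ h₃ hA) (wmOfInput W) (thetaOf _ (thetaClassInputOf _ (fun V c => thetaSpaceInputOf hHD hI h₁ h₃ S V c))) (d12Of μ) (d34Of μ)).Theta V c i Γ ⊆
          (picardCMUniverse hHD hI h₁ h₃).Uiso Γ M (inflate k (c.Ψ i)) σ')
    (thetaSat : ∀ {L : CMField} {ι₁ : L →+* ℂ} (V : HermSpace3 L ι₁) (c : SeesawCtx L)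
      (i : Fin 4) (Γ Γ' : Level V) (hle : Γ' ≤ Γ) (ω : (picardCMUniverse hHD hI h₁ h₃).CohC ((picardCMUniverse hHD hI h₁ h₃).pms L ι₁ V Γ) 1),
      ω ∈ (thetaModelOf hHD hI h₁ h₃ h (embOf hHD hI h₁ h₃) (coverOf hHD hI h₁ h₃ hA) (wmOfInput W) (thetaOf _ (thetaClassInputOf _ (fun V c => thetaSpaceInputOf hHD hI h₁ h₃ S V c))) (d12Of μ) (d34Of μ)).Theta V c i Γ →
        (picardCMUniverse hHD hI h₁ h₃).pullC (coverOf hHD hI h₁ h₃ hA Γ Γ' (Level.Γ_mono hle)) 1 ω ∈ (thetaModelOf hHD hI h₁ h₃ h (embOf hHD hI h₁ h₃) (coverOf hHD hI h₁ h₃ hA) (wmOfInput W) (thetaOf _ (thetaClassInputOf _ (fun V c => thetaSpaceInputOf hHD hI h₁ h₃ S V c))) (d12Of μ) (d34Of μ)).Theta V c i Γ')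
    (transl : ∀ {L : CMField} {ι₁ : L →+* ℂ} (V : HermSpace3 L ι₁) (c : SeesawCtx L)
      (hc : (thetaModelOf hHD hI h₁ h₃ h (embOf hHD hI h₁ h₃) (coverOf hHD hI h₁ h₃ hA) (wmOfInput W) (thetaOf _ (thetaClassInputOf _ (fun V c => thetaSpaceInputOf hHD hI h₁ h₃ S V c))) (d12Of μ) (d34Of μ)).GoodCtx ι₁ c) (hK : Module.finrank ℚ c.K = 6),
      ∀ γ ∈ (ballOf hHD hI h₁ h₃ V c (two_lt_finrank_of_goodCtx hHD hI h₁ h₃ hc hK)).Δ, ∀ (i : Fin 4) (Γ : Level V) (ω : (picardCMUniverse hHD hI h₁ h₃).CohC ((picardCMUniverse hHD hI h₁ h₃).pms L ι₁ V Γ) 1),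
      ω ∈ (thetaModelOf hHD hI h₁ h₃ h (embOf hHD hI h₁ h₃) (coverOf hHD hI h₁ h₃ hA) (wmOfInput W) (thetaOf _ (thetaClassInputOf _ (fun V c => thetaSpaceInputOf hHD hI h₁ h₃ S V c))) (d12Of μ) (d34Of μ)).Theta V c i Γ → ∃ (Γ' : Level V) (ω' : (picardCMUniverse hHD hI h₁ h₃).CohC ((picardCMUniverse hHD hI h₁ h₃).pms L ι₁ V Γ') 1),
        ω' ∈ (thetaModelOf hHD hI h₁ h₃ h (embOf hHD hI h₁ h₃) (coverOf hHD hI h₁ h₃ hA) (wmOfInput W) (thetaOf _ (thetaClassInputOf _ (fun V c => thetaSpaceInputOf hHD hI h₁ h₃ S V c))) (d12Of μ) (d34Of μ)).Theta V c i Γ' ∧ (ballOf hHD hI h₁ h₃ V c (two_lt_finrank_of_goodCtx hHD hI h₁ h₃ hc hK)).ev Γ' ω' =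
          fun x => (ballOf hHD hI h₁ h₃ V c (two_lt_finrank_of_goodCtx hHD hI h₁ h₃ hc hK)).J γ x *ᵥ (ballOf hHD hI h₁ h₃ V c (two_lt_finrank_of_goodCtx hHD hI h₁ h₃ hc hK)).ev Γ ω (γ • x))
    (C : ∀ {L : CMField} {ι₁ : L →+* ℂ} (V : HermSpace3 L ι₁) (c : SeesawCtx L) (hV : IsAnisotropic L V.Hm),
      (thetaModelOf hHD hI h₁ h₃ h (embOf hHD hI h₁ h₃) (coverOf hHD hI h₁ h₃ hA) (wmOfInput W) (thetaOf _ (thetaClassInputOf _ (fun V c => thetaSpaceInputOf hHD hI h₁ h₃ S V c))) (d12Of μ) (d34Of μ)).GoodCtx ι₁ c →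
      Module.finrank ℚ c.K = 6 → ∀ k : Fin 4, k = 0 ∨ k = 1 → ∀ N : ℕ, 0 < N →
        ArchKTypeData (thetaSpaceInputIn hHD hI h₁ h₃ (S V c) hV) k N)
    (hol : ∀ {L : CMField} {ι₁ : L →+* ℂ} (V : HermSpace3 L ι₁) (c : SeesawCtx L) (hV : IsAnisotropic L V.Hm)
      (hc : (thetaModelOf hHD hI h₁ h₃ h (embOf hHD hI h₁ h₃) (coverOf hHD hI h₁ h₃ hA) (wmOfInput W) (thetaOf _ (thetaClassInputOf _ (fun V c => thetaSpaceInputOf hHD hI h₁ h₃ S V c))) (d12Of μ) (d34Of μ)).GoodCtx ι₁ c)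
      (h6 : Module.finrank ℚ c.K = 6) (k : Fin 4) (hk : k = 0 ∨ k = 1) (N : ℕ) (hN : 0 < N),
      ∀ f ∈ ((thetaSpaceInputIn hHD hI h₁ h₃ (S V c) hV).P k).weightFunctions,
        (C V c hV hc h6 k hk N hN).toProduct.restrictedThetaForm f ∈
          ((thetaSpaceInputIn hHD hI h₁ h₃ (S V c) hV).D (C V c hV hc h6 k hk N hN).Γ₀).Hol)
    (gen12 : ∀ {L : CMField} {ι₁ : L →+* ℂ} (V : HermSpace3 L ι₁) (c : SeesawCtx L),
      (thetaModelOf hHD hI h₁ h₃ h (embOf hHD hI h₁ h₃) (coverOf hHD hI h₁ h₃ hA) (wmOfInput W) (thetaOf _ (thetaClassInputOf _ (fun V c => thetaSpaceInputOf hHD hI h₁ h₃ S V c))) (d12Of μ) (d34Of μ)).GoodCtx ι₁ c → Module.finrank ℚ c.K = 6 →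
      Nonempty ((thetaModelOf hHD hI h₁ h₃ h (embOf hHD hI h₁ h₃) (coverOf hHD hI h₁ h₃ hA) (wmOfInput W) (thetaOf _ (thetaClassInputOf _ (fun V c => thetaSpaceInputOf hHD hI h₁ h₃ S V c))) (d12Of μ) (d34Of μ)).Gen12FunBridge V c))
    (real34 : ∀ {L : CMField} {ι₁ : L →+* ℂ} (V : HermSpace3 L ι₁) (c : SeesawCtx L),
      (thetaModelOf hHD hI h₁ h₃ h (embOf hHD hI h₁ h₃) (coverOf hHD hI h₁ h₃ hA) (wmOfInput W) (thetaOf _ (thetaClassInputOf _ (fun V c => thetaSpaceInputOf hHD hI h₁ h₃ S V c))) (d12Of μ) (d34Of μ)).GoodCtx ι₁ c → Module.finrank ℚ c.K = 6 →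
      Nonempty ((thetaModelOf hHD hI h₁ h₃ h (embOf hHD hI h₁ h₃) (coverOf hHD hI h₁ h₃ hA) (wmOfInput W) (thetaOf _ (thetaClassInputOf _ (fun V c => thetaSpaceInputOf hHD hI h₁ h₃ S V c))) (d12Of μ) (d34Of μ)).Real34FunBridge V c))
    (hyp12 : ∀ {L : CMField} {ι₁ : L →+* ℂ} (V : HermSpace3 L ι₁) (c : SeesawCtx L),
      (thetaModelOf hHD hI h₁ h₃ h (embOf hHD hI h₁ h₃) (coverOf hHD hI h₁ h₃ hA) (wmOfInput W) (thetaOf _ (thetaClassInputOf _ (fun V c => thetaSpaceInputOf hHD hI h₁ h₃ S V c))) (d12Of μ) (d34Of μ)).GoodCtx ι₁ c → Module.finrank ℚ c.K = 6 →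
      Nonempty (((coreOf _ (embOf hHD hI h₁ h₃) (coverOf hHD hI h₁ h₃ hA) (wmOfInput W) (thetaOf _ (thetaClassInputOf _ (fun V c => thetaSpaceInputOf hHD hI h₁ h₃ S V c)))).toCore h).HypSmoothCore12
        (((coreOf _ (embOf hHD hI h₁ h₃) (coverOf hHD hI h₁ h₃ hA) (wmOfInput W) (thetaOf _ (thetaClassInputOf _ (fun V c => thetaSpaceInputOf hHD hI h₁ h₃ S V c)))).toCore h).side12 (d12Of μ)) (((coreOf _ (embOf hHD hI h₁ h₃) (coverOf hHD hI h₁ h₃ hA) (wmOfInput W) (thetaOf _ (thetaClassInputOf _ (fun V c => thetaSpaceInputOf hHD hI h₁ h₃ S V c)))).toCore h).side34 (d34Of μ))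
        ((((coreOf _ (embOf hHD hI h₁ h₃) (coverOf hHD hI h₁ h₃ hA) (wmOfInput W) (thetaOf _ (thetaClassInputOf _ (fun V c => thetaSpaceInputOf hHD hI h₁ h₃ S V c)))).toCore h).analyticKM (((coreOf _ (embOf hHD hI h₁ h₃) (coverOf hHD hI h₁ h₃ hA) (wmOfInput W) (thetaOf _ (thetaClassInputOf _ (fun V c => thetaSpaceInputOf hHD hI h₁ h₃ S V c)))).toCore h).side12 (d12Of μ))
          (((coreOf _ (embOf hHD hI h₁ h₃) (coverOf hHD hI h₁ h₃ hA) (wmOfInput W) (thetaOf _ (thetaClassInputOf _ (fun V c => thetaSpaceInputOf hHD hI h₁ h₃ S V c)))).toCore h).side34 (d34Of μ))).toAnalytic) V c (ℓ := linOfInput W V c)))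
    (hyp34 : ∀ {L : CMField} {ι₁ : L →+* ℂ} (V : HermSpace3 L ι₁) (c : SeesawCtx L),
      (thetaModelOf hHD hI h₁ h₃ h (embOf hHD hI h₁ h₃) (coverOf hHD hI h₁ h₃ hA) (wmOfInput W) (thetaOf _ (thetaClassInputOf _ (fun V c => thetaSpaceInputOf hHD hI h₁ h₃ S V c))) (d12Of μ) (d34Of μ)).GoodCtx ι₁ c → Module.finrank ℚ c.K = 6 →
      Nonempty (((coreOf _ (embOf hHD hI h₁ h₃) (coverOf hHD hI h₁ h₃ hA) (wmOfInput W) (thetaOf _ (thetaClassInputOf _ (fun V c => thetaSpaceInputOf hHD hI h₁ h₃ S V c)))).toCore h).HypSmoothCore34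
        (((coreOf _ (embOf hHD hI h₁ h₃) (coverOf hHD hI h₁ h₃ hA) (wmOfInput W) (thetaOf _ (thetaClassInputOf _ (fun V c => thetaSpaceInputOf hHD hI h₁ h₃ S V c)))).toCore h).side12 (d12Of μ)) (((coreOf _ (embOf hHD hI h₁ h₃) (coverOf hHD hI h₁ h₃ hA) (wmOfInput W) (thetaOf _ (thetaClassInputOf _ (fun V c => thetaSpaceInputOf hHD hI h₁ h₃ S V c)))).toCore h).side34 (d34Of μ))
        ((((coreOf _ (embOf hHD hI h₁ h₃) (coverOf hHD hI h₁ h₃ hA) (wmOfInput W) (thetaOf _ (thetaClassInputOf _ (fun V c => thetaSpaceInputOf hHD hI h₁ h₃ S V c)))).toCore h).analyticKM (((coreOf _ (embOf hHD hI h₁ h₃) (coverOf hHD hI h₁ h₃ hA) (wmOfInput W) (thetaOf _ (thetaClassInputOf _ (fun V c => thetaSpaceInputOf hHD hI h₁ h₃ S V c)))).toCore h).side12 (d12Of μ))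
          (((coreOf _ (embOf hHD hI h₁ h₃) (coverOf hHD hI h₁ h₃ hA) (wmOfInput W) (thetaOf _ (thetaClassInputOf _ (fun V c => thetaSpaceInputOf hHD hI h₁ h₃ S V c)))).toCore h).side34 (d34Of μ))).toAnalytic) V c (ℓ := linOfInput W V c))) :
     (picardCMUniverse hHD hI h₁ h₃).PerL :=
  perL_picardCM_r9core hHD hI h₁ h₃ hHR h hA W S μ hBetti (fact_cmInflation_riemann hHD hI h₃ h₁ hR)
    hLiu thetaSat transl C hol gen12 real34 hyp12 hyp34

/-- **E2 instance, revision 9 — printed-split variant.** `Model.perL_picardCM_r9core` at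
`h31 := Model.fact_cmInflation_printed hHD hI h₃ h₁ hd ha` (mc-axioms-1-g3, the route of revisions 5–7); binders
`hd : Shimura1998_Thm3_isogenousPower`, `ha : Shimura1998_Thm2_Cor` replace `h31`. -/
theorem perL_picardCM_r9s (hHR : BettiUniverse.HodgeRiemann20) (h : Bool)
    (hA : Arapura2012_Cor_15_4_6)
    (W : ∀ {L : CMField} {ι₁ : L →+* ℂ} (V : HermSpace3 L ι₁) (c : SeesawCtx L), WmInput V c.D)
    (S : ∀ {L : CMField} {ι₁ : L →+* ℂ} (V : HermSpace3 L ι₁) (c : SeesawCtx L), ThetaAdelicSide V c)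
    (μ : ∀ {L : CMField}, SeesawCtx L → Fin 4 → NumberField.InfinitePlace L → ℤ)
    (hBetti : ∀ {L : CMField} {ι₁ : L →+* ℂ} (V : HermSpace3 L ι₁), EmbBettiSide hHD hI h₁ h₃ V)
    (hd : Shimura1998_Thm3_isogenousPower) (ha : Shimura1998_Thm2_Cor)
    (hLiu : ∀ {L : CMField} {ι₁ : L →+* ℂ} (V : HermSpace3 L ι₁) (c : SeesawCtx L),
      (thetaModelOf hHD hI h₁ h₃ h (embOf hHD hI h₁ h₃) (coverOf hHD hI h₁ h₃ hA) (wmOfInput W) (thetaOf _ (thetaClassInputOf _ (fun V c => thetaSpaceInputOf hHD hI h₁ h₃ S V c))) (d12Of μ) (d34Of μ)).GoodCtx ι₁ c → Module.finrank ℚ c.K = 6 →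
      ∀ (i : Fin 4) (Γ : Level V), ∃ (M : CMField) (k : c.K →+* M) (σ' : M →+* ℂ), σ'.comp k = c.σ ∧
        (thetaModelOf hHD hI h₁ h₃ h (embOf hHD hI h₁ h₃) (coverOf hHD hI h₁ h₃ hA) (wmOfInput W) (thetaOf _ (thetaClassInputOf _ (fun V c => thetaSpaceInputOf hHD hI h₁ h₃ S V c))) (d12Of μ) (d34Of μ)).Theta V c i Γ ⊆
          (picardCMUniverse hHD hI h₁ h₃).Uiso Γ M (inflate k (c.Ψ i)) σ')
    (thetaSat : ∀ {L : CMField} {ι₁ : L →+* ℂ} (V : HermSpace3 L ι₁) (c : SeesawCtx L)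
      (i : Fin 4) (Γ Γ' : Level V) (hle : Γ' ≤ Γ) (ω : (picardCMUniverse hHD hI h₁ h₃).CohC ((picardCMUniverse hHD hI h₁ h₃).pms L ι₁ V Γ) 1),
      ω ∈ (thetaModelOf hHD hI h₁ h₃ h (embOf hHD hI h₁ h₃) (coverOf hHD hI h₁ h₃ hA) (wmOfInput W) (thetaOf _ (thetaClassInputOf _ (fun V c => thetaSpaceInputOf hHD hI h₁ h₃ S V c))) (d12Of μ) (d34Of μ)).Theta V c i Γ →
        (picardCMUniverse hHD hI h₁ h₃).pullC (coverOf hHD hI h₁ h₃ hA Γ Γ' (Level.Γ_mono hle)) 1 ω ∈ (thetaModelOf hHD hI h₁ h₃ h (embOf hHD hI h₁ h₃) (coverOf hHD hI h₁ h₃ hA) (wmOfInput W) (thetaOf _ (thetaClassInputOf _ (fun V c => thetaSpaceInputOf hHD hI h₁ h₃ S V c))) (d12Of μ) (d34Of μ)).Theta V c i Γ')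
    (transl : ∀ {L : CMField} {ι₁ : L →+* ℂ} (V : HermSpace3 L ι₁) (c : SeesawCtx L)
      (hc : (thetaModelOf hHD hI h₁ h₃ h (embOf hHD hI h₁ h₃) (coverOf hHD hI h₁ h₃ hA) (wmOfInput W) (thetaOf _ (thetaClassInputOf _ (fun V c => thetaSpaceInputOf hHD hI h₁ h₃ S V c))) (d12Of μ) (d34Of μ)).GoodCtx ι₁ c) (hK : Module.finrank ℚ c.K = 6),
      ∀ γ ∈ (ballOf hHD hI h₁ h₃ V c (two_lt_finrank_of_goodCtx hHD hI h₁ h₃ hc hK)).Δ, ∀ (i : Fin 4) (Γ : Level V) (ω : (picardCMUniverse hHD hI h₁ h₃).CohC ((picardCMUniverse hHD hI h₁ h₃).pms L ι₁ V Γ) 1),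
      ω ∈ (thetaModelOf hHD hI h₁ h₃ h (embOf hHD hI h₁ h₃) (coverOf hHD hI h₁ h₃ hA) (wmOfInput W) (thetaOf _ (thetaClassInputOf _ (fun V c => thetaSpaceInputOf hHD hI h₁ h₃ S V c))) (d12Of μ) (d34Of μ)).Theta V c i Γ → ∃ (Γ' : Level V) (ω' : (picardCMUniverse hHD hI h₁ h₃).CohC ((picardCMUniverse hHD hI h₁ h₃).pms L ι₁ V Γ') 1),
        ω' ∈ (thetaModelOf hHD hI h₁ h₃ h (embOf hHD hI h₁ h₃) (coverOf hHD hI h₁ h₃ hA) (wmOfInput W) (thetaOf _ (thetaClassInputOf _ (fun V c => thetaSpaceInputOf hHD hI h₁ h₃ S V c))) (d12Of μ) (d34Of μ)).Theta V c i Γ' ∧ (ballOf hHD hI h₁ h₃ V c (two_lt_finrank_of_goodCtx hHD hI h₁ h₃ hc hK)).ev Γ' ω' =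
          fun x => (ballOf hHD hI h₁ h₃ V c (two_lt_finrank_of_goodCtx hHD hI h₁ h₃ hc hK)).J γ x *ᵥ (ballOf hHD hI h₁ h₃ V c (two_lt_finrank_of_goodCtx hHD hI h₁ h₃ hc hK)).ev Γ ω (γ • x))
    (C : ∀ {L : CMField} {ι₁ : L →+* ℂ} (V : HermSpace3 L ι₁) (c : SeesawCtx L) (hV : IsAnisotropic L V.Hm),
      (thetaModelOf hHD hI h₁ h₃ h (embOf hHD hI h₁ h₃) (coverOf hHD hI h₁ h₃ hA) (wmOfInput W) (thetaOf _ (thetaClassInputOf _ (fun V c => thetaSpaceInputOf hHD hI h₁ h₃ S V c))) (d12Of μ) (d34Of μ)).GoodCtx ι₁ c →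
      Module.finrank ℚ c.K = 6 → ∀ k : Fin 4, k = 0 ∨ k = 1 → ∀ N : ℕ, 0 < N →
        ArchKTypeData (thetaSpaceInputIn hHD hI h₁ h₃ (S V c) hV) k N)
    (hol : ∀ {L : CMField} {ι₁ : L →+* ℂ} (V : HermSpace3 L ι₁) (c : SeesawCtx L) (hV : IsAnisotropic L V.Hm)
      (hc : (thetaModelOf hHD hI h₁ h₃ h (embOf hHD hI h₁ h₃) (coverOf hHD hI h₁ h₃ hA) (wmOfInput W) (thetaOf _ (thetaClassInputOf _ (fun V c => thetaSpaceInputOf hHD hI h₁ h₃ S V c))) (d12Of μ) (d34Of μ)).GoodCtx ι₁ c)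
      (h6 : Module.finrank ℚ c.K = 6) (k : Fin 4) (hk : k = 0 ∨ k = 1) (N : ℕ) (hN : 0 < N),
      ∀ f ∈ ((thetaSpaceInputIn hHD hI h₁ h₃ (S V c) hV).P k).weightFunctions,
        (C V c hV hc h6 k hk N hN).toProduct.restrictedThetaForm f ∈
          ((thetaSpaceInputIn hHD hI h₁ h₃ (S V c) hV).D (C V c hV hc h6 k hk N hN).Γ₀).Hol)
    (gen12 : ∀ {L : CMField} {ι₁ : L →+* ℂ} (V : HermSpace3 L ι₁) (c : SeesawCtx L),
      (thetaModelOf hHD hI h₁ h₃ h (embOf hHD hI h₁ h₃) (coverOf hHD hI h₁ h₃ hA) (wmOfInput W) (thetaOf _ (thetaClassInputOf _ (fun V c => thetaSpaceInputOf hHD hI h₁ h₃ S V c))) (d12Of μ) (d34Of μ)).GoodCtx ι₁ c → Module.finrank ℚ c.K = 6 →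
      Nonempty ((thetaModelOf hHD hI h₁ h₃ h (embOf hHD hI h₁ h₃) (coverOf hHD hI h₁ h₃ hA) (wmOfInput W) (thetaOf _ (thetaClassInputOf _ (fun V c => thetaSpaceInputOf hHD hI h₁ h₃ S V c))) (d12Of μ) (d34Of μ)).Gen12FunBridge V c))
    (real34 : ∀ {L : CMField} {ι₁ : L →+* ℂ} (V : HermSpace3 L ι₁) (c : SeesawCtx L),
      (thetaModelOf hHD hI h₁ h₃ h (embOf hHD hI h₁ h₃) (coverOf hHD hI h₁ h₃ hA) (wmOfInput W) (thetaOf _ (thetaClassInputOf _ (fun V c => thetaSpaceInputOf hHD hI h₁ h₃ S V c))) (d12Of μ) (d34Of μ)).GoodCtx ι₁ c → Module.finrank ℚ c.K = 6 →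
      Nonempty ((thetaModelOf hHD hI h₁ h₃ h (embOf hHD hI h₁ h₃) (coverOf hHD hI h₁ h₃ hA) (wmOfInput W) (thetaOf _ (thetaClassInputOf _ (fun V c => thetaSpaceInputOf hHD hI h₁ h₃ S V c))) (d12Of μ) (d34Of μ)).Real34FunBridge V c))
    (hyp12 : ∀ {L : CMField} {ι₁ : L →+* ℂ} (V : HermSpace3 L ι₁) (c : SeesawCtx L),
      (thetaModelOf hHD hI h₁ h₃ h (embOf hHD hI h₁ h₃) (coverOf hHD hI h₁ h₃ hA) (wmOfInput W) (thetaOf _ (thetaClassInputOf _ (fun V c => thetaSpaceInputOf hHD hI h₁ h₃ S V c))) (d12Of μ) (d34Of μ)).GoodCtx ι₁ c → Module.finrank ℚ c.K = 6 →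
      Nonempty (((coreOf _ (embOf hHD hI h₁ h₃) (coverOf hHD hI h₁ h₃ hA) (wmOfInput W) (thetaOf _ (thetaClassInputOf _ (fun V c => thetaSpaceInputOf hHD hI h₁ h₃ S V c)))).toCore h).HypSmoothCore12
        (((coreOf _ (embOf hHD hI h₁ h₃) (coverOf hHD hI h₁ h₃ hA) (wmOfInput W) (thetaOf _ (thetaClassInputOf _ (fun V c => thetaSpaceInputOf hHD hI h₁ h₃ S V c)))).toCore h).side12 (d12Of μ)) (((coreOf _ (embOf hHD hI h₁ h₃) (coverOf hHD hI h₁ h₃ hA) (wmOfInput W) (thetaOf _ (thetaClassInputOf _ (fun V c => thetaSpaceInputOf hHD hI h₁ h₃ S V c)))).toCore h).side34 (d34Of μ))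
        ((((coreOf _ (embOf hHD hI h₁ h₃) (coverOf hHD hI h₁ h₃ hA) (wmOfInput W) (thetaOf _ (thetaClassInputOf _ (fun V c => thetaSpaceInputOf hHD hI h₁ h₃ S V c)))).toCore h).analyticKM (((coreOf _ (embOf hHD hI h₁ h₃) (coverOf hHD hI h₁ h₃ hA) (wmOfInput W) (thetaOf _ (thetaClassInputOf _ (fun V c => thetaSpaceInputOf hHD hI h₁ h₃ S V c)))).toCore h).side12 (d12Of μ))
          (((coreOf _ (embOf hHD hI h₁ h₃) (coverOf hHD hI h₁ h₃ hA) (wmOfInput W) (thetaOf _ (thetaClassInputOf _ (fun V c => thetaSpaceInputOf hHD hI h₁ h₃ S V c)))).toCore h).side34 (d34Of μ))).toAnalytic) V c (ℓ := linOfInput W V c)))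
    (hyp34 : ∀ {L : CMField} {ι₁ : L →+* ℂ} (V : HermSpace3 L ι₁) (c : SeesawCtx L),
      (thetaModelOf hHD hI h₁ h₃ h (embOf hHD hI h₁ h₃) (coverOf hHD hI h₁ h₃ hA) (wmOfInput W) (thetaOf _ (thetaClassInputOf _ (fun V c => thetaSpaceInputOf hHD hI h₁ h₃ S V c))) (d12Of μ) (d34Of μ)).GoodCtx ι₁ c → Module.finrank ℚ c.K = 6 →
      Nonempty (((coreOf _ (embOf hHD hI h₁ h₃) (coverOf hHD hI h₁ h₃ hA) (wmOfInput W) (thetaOf _ (thetaClassInputOf _ (fun V c => thetaSpaceInputOf hHD hI h₁ h₃ S V c)))).toCore h).HypSmoothCore34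
        (((coreOf _ (embOf hHD hI h₁ h₃) (coverOf hHD hI h₁ h₃ hA) (wmOfInput W) (thetaOf _ (thetaClassInputOf _ (fun V c => thetaSpaceInputOf hHD hI h₁ h₃ S V c)))).toCore h).side12 (d12Of μ)) (((coreOf _ (embOf hHD hI h₁ h₃) (coverOf hHD hI h₁ h₃ hA) (wmOfInput W) (thetaOf _ (thetaClassInputOf _ (fun V c => thetaSpaceInputOf hHD hI h₁ h₃ S V c)))).toCore h).side34 (d34Of μ))
        ((((coreOf _ (embOf hHD hI h₁ h₃) (coverOf hHD hI h₁ h₃ hA) (wmOfInput W) (thetaOf _ (thetaClassInputOf _ (fun V c => thetaSpaceInputOf hHD hI h₁ h₃ S V c)))).toCore h).analyticKM (((coreOf _ (embOf hHD hI h₁ h₃) (coverOf hHD hI h₁ h₃ hA) (wmOfInput W) (thetaOf _ (thetaClassInputOf _ (fun V c => thetaSpaceInputOf hHD hI h₁ h₃ S V c)))).toCore h).side12 (d12Of μ))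
          (((coreOf _ (embOf hHD hI h₁ h₃) (coverOf hHD hI h₁ h₃ hA) (wmOfInput W) (thetaOf _ (thetaClassInputOf _ (fun V c => thetaSpaceInputOf hHD hI h₁ h₃ S V c)))).toCore h).side34 (d34Of μ))).toAnalytic) V c (ℓ := linOfInput W V c))) :
     (picardCMUniverse hHD hI h₁ h₃).PerL :=
  perL_picardCM_r9core hHD hI h₁ h₃ hHR h hA W S μ hBetti (fact_cmInflation_printed hHD hI h₃ h₁ hd ha)
    hLiu thetaSat transl C hol gen12 real34 hyp12 hyp34

end Model

end HodgeCM
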